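import Summits.PneNP.PneNP.Theorems.PhaseTwinsNoFBPPApproxAboveUniquenessGraphCanon
import Summits.PneNP.PneNP.Theorems.PhaseTwinsNoFBPPApproxAboveUniquenessIndepVerifier
import Summits.PneNP.PneNP.Theorems.PhaseTwinsNoFBPPApproxAboveUniquenessMaxDegreeTest
import Summits.PneNP.PneNP.Theorems.PhaseTwinsNoFBPPApproxAboveUniquenessSharpPAssembly

/-!
# `HardcoreCountSharpP` for line `SketchIdeator1` of crux stmt-PneNP-2717: the hard-core count is in `#P`

The route's support item `HardcoreCountSharpP` (stmt-PneNP-2722; hypothesis of the route's Assembly and of the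
line's Theorem N), assembled from the line's landed pieces: the graph-code canonicalisation `stub_graphCanon`
(T1), the independent-set verifier `stub_indepVerifier` (T2a), the degree test `stub_maxDegreeTest` (T2b) and
the `#P`-closure assembly `stub_sharpPAssembly` (T4′). (An independent proof of the same item by the seat of
stmt-PneNP-2722 is `Summit.PneNP.PneNP.Theorems.hardcoreCountSharpP_proof` in
`Theorems/PhaseTwinsHardcoreCountSharpP.lean`; the two developments share no code.)
-/

set_option linter.dupNamespace false

namespace Summit.PneNP.PneNP.Theorems.NoFBPPApproxAboveUniqueness

open Summit.PneNP.PneNP.Theses.PhaseTwins (HardcoreCountSharpP)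

/-- **The hard-core counting function `N_{Δ,p,q}` is a `#P` function** — the route's support item
`HardcoreCountSharpP` (stmt-PneNP-2722), verbatim (registered sub-goal `hardcoreCount_mem_SharpP` of crux
stmt-PneNP-2717's line). [cite: Valiant1979, §2] -/
theorem hardcoreCount_mem_SharpP : HardcoreCountSharpP :=
  stub_sharpPAssembly stub_graphCanon stub_indepVerifier stub_maxDegreeTest

end Summit.PneNP.PneNP.Theorems.NoFBPPApproxAboveUniqueness
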